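import Summits.BirchSwinnertonDyer.BirchSwinnertonDyer.Theorems.SignedBaseChangeAnticyclotomicEisensteinDivisibilityOfStubsAdmdefV14
import Literature.NumberTheory.EllipticCurves.DefiniteBrandtMultiplicityOneModP
import Literature.NumberTheory.EllipticCurves.CastellaHsuKunduLeeLiu2025.SignedBipartiteSystemTransferClassDictionary

/-! # Line `admdef` v15: the KERNEL CENSUS after the two typing targets LANDED — the crux BY NAME from the FOUR v15 stub texts
# (cite ×16 · S1∣ · (Anch±) signed [weighted period] · γ′)

Crux `AnticyclotomicEisensteinDivisibility` (stmt-BirchSwinnertonDyer-20727, route `SignedBaseChange`), line `admdef`, skeleton **v15** (LEAD bsd-line-sbc-p1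
gen 20, sha16 a971fa4d377eafea; tree `Cruxes/AnticyclotomicEisensteinDivisibility/Lines/admdef.lean` ef43958c465a).  v15 CONSUMES BY NAME the two PRINT typing
targets of v13/v14: `SpecMult1` = the typed named fact `DefiniteMultiplicityOne.kimOta2023_thm55_brandtEigenvector_modP_unique` (typer row bsd-inputs-honda-p1
g17, p746851: multiplicity one mod `p` on the definite side in `mulVec`-eigenvector form, PW11 Thm 6.2 / KO23 Thm 5.5, with print's good-reduction binder) and
`SpecP0P1` = the typed named fact `CastellaHsuKunduLeeLiu2025.thm74_eq72_exists_signedSystem_transferClass_dictionary` (p747068: CHKLL25 Thm 7.4 WITH its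
construction — (7.1) = (7.2), Castella–Wan's transfer inputs, and the WEIGHTED definite dictionary at `j = 1`, = `Lines/admdef_bridge_spec.lean` v2 verbatim);
they are conjuncts (15)–(16) of the cite stub.  THIS FILE: the v14/v15 BRIDGE text FROM THE TWO NAMED FACTS (`bridge_text_of_facts`, kernel: the v14 census
glue with `hgood` passed) and **the crux BY NAME from the FOUR v15 stub texts as hypotheses** (`anticyclotomicEisensteinDivisibility_of_admdefStubsV15`, through
the v14 census's weighted [NV″] glue, §Glue and the v4 census; `_noBLV` road included).  By-name glue for a route-pen `--split 20727` along admdef v15's cut.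
CONDITIONAL (audit `proof.conditional`); BSD / the crux / (Anch±) are NOT proved by this file (`--supports stmt-BirchSwinnertonDyer-20727`).
[cite: CastellaEtAl2025, Thm. 7.4, Thm. 7.5, (7.1)–(7.2), §7.4 (arXiv:2308.10474v2 pp. 30–33)] [cite: KimOta2023, Thm. 5.5] [cite: PollackWeston2011, Thm. 6.2]
[cite: WZhang2014, Thm. 9.1 (proof)]
-/

-- D-0017: single-problem summit, the namespace repeats the problem name by design.
set_option linter.dupNamespace false
set_option autoImplicit false

noncomputable section

open scoped Classical NumberField

open NumberField IsDedekindDomain Field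
  Literature.NumberTheory.EllipticCurves Literature.NumberTheory.EllipticCurves.ModularForms
  Literature.NumberTheory.EllipticCurves.Rank1Residual Literature.NumberTheory.EllipticCurves.Castella2018
  Literature.NumberTheory.EllipticCurves.CastellaWan2024 Literature.NumberTheory.GaloisRepresentations
  Literature.NumberTheory.EllipticCurves.YanZhu2026 Literature.NumberTheory.Automorphic
  Summit.BirchSwinnertonDyer.Rank1Residual.X11b Summit.BirchSwinnertonDyer.Rank1Residual.X11b.Halves
  Summit.BirchSwinnertonDyer.BirchSwinnertonDyer.Theorems
open Literature.NumberTheory.EllipticCurves.AcSigned Literature.NumberTheory.EllipticCurves.CastellaHsuKunduLeeLiu2025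
  Literature.NumberTheory.EllipticCurves.BertoliniDarmon2005

namespace Summit.BirchSwinnertonDyer.BirchSwinnertonDyer.Theorems.SignedBaseChangeAcDivOfStubsAdmdefV15

open Summit.BirchSwinnertonDyer.BirchSwinnertonDyer.Theses.SignedBaseChange
open Summit.BirchSwinnertonDyer.BirchSwinnertonDyer.Theorems

/-- **The v14/v15 BRIDGE text FROM THE TWO TYPED NAMED FACTS (kernel).**  Hypotheses BY NAME: CHKLL25 Thm 7.4-with-construction
(`thm74_eq72_exists_signedSystem_transferClass_dictionary`) and multiplicity one mod `p` (`kimOta2023_thm55_brandtEigenvector_modP_unique`); conclusion = the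
body of `AdmdefLine.SignedBipartiteBridgeNS` v14/v15 (WEIGHTED period) VERBATIM.  Proof = the v14 census glue with the good-reduction hypothesis passed to the
multiplicity-one fact. [cite: CastellaEtAl2025, §7.4 L1–3, (7.4), p. 32 L50–63 (arXiv:2308.10474v2 pp. 32–33)] [cite: KimOta2023, Thm. 5.5] [cite: PollackWeston2011, Thm. 6.2] -/
theorem bridge_text_of_facts
    (hP : Literature.NumberTheory.EllipticCurves.CastellaHsuKunduLeeLiu2025.thm74_eq72_exists_signedSystem_transferClass_dictionary)
    (hM : Literature.NumberTheory.EllipticCurves.DefiniteMultiplicityOne.kimOta2023_thm55_brandtEigenvector_modP_unique) :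
    ∀ {p : ℕ} [Fact p.Prime] (ι : PadicAlgCl p ≃+* ℂ) (W : WeierstrassCurve ℚ) [W.IsElliptic]
      [W.IsGloballyMinimal] (K : Type) [Field K] [NumberField K]
      (𝔭 𝔭bar : HeightOneSpectrum (𝓞 K)) (κ : ZpExtension K p) (γ : absoluteGaloisGroup K)
      [hγF : Fact (κ.IsTopGenerator γ)] {N : ℕ} [NeZero N] {f : CuspForm (CongruenceSubgroup.Gamma0 N) 2}
      (_ : IsNewformOf W f),
      (N : ℤ) = W.conductorNorm ℤ → 5 ≤ p → W.HasGoodReductionAtPrime p → W.frobeniusTrace p = 0 →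
      Surj W p →
      IsImaginaryQuadratic K → ((Ideal.span {(p : ℤ)}).primesOver (𝓞 K)).ncard = 2 →
        (h𝔭 : ((p : ℕ) : 𝓞 K) ∈ 𝔭.asIdeal) →
        (∀ (w : InfinitePlace K) (k : 𝓞 K), k ∈ 𝔭.asIdeal ↔ ‖ι.symm (w.embedding (k : K))‖ < 1) →
        ((p : ℕ) : 𝓞 K) ∈ 𝔭bar.asIdeal → (hne : 𝔭bar ≠ 𝔭) →
      (∀ ℓ : ℕ, ℓ.Prime → ℓ ∣ N → ((Ideal.span {(ℓ : ℤ)}).primesOver (𝓞 K)).ncard = 2) →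
      IsCoprime (N : ℤ) (NumberField.discr K) → ¬ p ∣ NumberField.classNumber K →
      -- (i) NEGATED: `N` is NOT square-free
      ¬ Squarefree N →
      -- (ii): `E[p]` ramified at every prime `q ∣ N`
      (∀ q : ℕ, q.Prime → q ∣ N →
        ∃ v : HeightOneSpectrum (𝓞 ℚ), ((q : ℕ) : 𝓞 ℚ) ∈ v.asIdeal ∧
          ∃ 𝔓 ∈ v.primesAbove, ∃ σ ∈ 𝔓.inertia (absoluteGaloisGroup ℚ),
            ∃ P : W.geomTorsion (p : ℤ), σ • P ≠ P) →
      κ.IsAnticyclotomic →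
      -- BRIDGE: frame, transfer class, `+` system at it, and «definite toric period ≠ 0 mod p ⟹ λ+_1(∏ s)(0) ∈ ℤ_pˣ»
      ∀ (h𝔭ns : AcSigned.IsNonsplitIn κ 𝔭) (γ𝔭 : absoluteGaloisGroup (𝔭.adicCompletion K))
        (hγ𝔭 : κ (resGalOfEmb (closureEmb (K := K) (𝔭.adicCompletion K)) γ𝔭) = κ γ),
        ∃ (ΩK : ℂ) (Ωp : (unrIntegers p)ˣ) (L : UnrSeries p), ΩK ≠ 0 ∧
          IsCWBDPLFunction ι 𝔭 κ γ f (NumberField.discr K) ΩK ((Ωp : unrIntegers p) : ℂ_[p]) L ∧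
          ∃ (z : AcSigned.selmerLambdaAdic (W.baseChange K) p κ γ (fun _ ↦ .sgn 1))
            (B : CastellaHsuKunduLeeLiu2025.SignedBipartiteSystem W K p κ),
            AcSigned.TransferInputs (W.baseChange K) p κ γ hγF.out 𝔭 h𝔭ns γ𝔭 hγ𝔭 𝔭bar (fun h ↦ hne h.symm) h𝔭 1 z L ∧
            CastellaHsuKunduLeeLiu2025.IsSignedBipartiteSystem W K p κ γ N 1 B ∧ B.IsLimitBaseClass z.1 ∧
            ∀ s : Finset ℕ, IsZhangAdmissibleLevel N K (fun ℓ ↦ W.frobeniusTrace ℓ) p s → Odd s.card →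
              (∃ (S : Brandt.XiSetup N (∏ q ∈ s, q)) (ψ : K →ₐ[ℚ] S.D) (I : Submodule ℤ S.D)
                  (φ : Brandt.ClassSet S.O → ZMod p),
                  Brandt.IsGrossPoint S.O ψ I ∧
                  (letI : Fintype (Brandt.ClassSet S.O) := Fintype.ofFinite _
                   φ ∈ Brandt.eigenSpace (ZMod p) (N * ∏ q ∈ s, q) (Brandt.matrix S.O) (fun ℓ ↦ W.frobeniusTrace ℓ)) ∧
                  Brandt.toricPeriod S.O ψ I (fun i ↦ (Brandt.weight S.O i : ZMod p) * φ i) ≠ 0) →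
              IsUnit (PowerSeries.constantCoeff (B.lam 1 (∏ q ∈ s, q))) := by
  intro p _ ι W _ _ K _ _ 𝔭 𝔭bar κ γ hγF N _ f hf hN hp hgood hap hsurj hK _hsplit h𝔭 hι h𝔭bar hne hHeeg hcop hh _hnsq
    hram hac h𝔭ns γ𝔭 hγ𝔭
  have hp2 : p ≠ 2 := by omega
  have hS : AcSigned.Setting W K p κ 𝔭 𝔭bar :=
    { isElliptic := ‹_›
      p_ne_two := hp2
      goodSS := ⟨hgood, by rw [hap]; exact dvd_zero _⟩
      frobeniusTrace_eq_zero := hap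
      isImaginaryQuadratic := hK
      mem := h𝔭
      mem' := h𝔭bar
      ne := hne
      anticyclotomic := hac
      not_dvd_classNumber := hh }
  have hN' : (W.conductorNorm ℤ : ℕ) = N := by exact_mod_cast hN.symm
  have hHg : SatisfiesHeegnerHypothesis N K := fun ℓ hℓ hℓN ↦ hHeeg ℓ hℓ hℓN
  obtain ⟨ΩK, Ωp, L, hΩ, hBDP, jbar, F, _hF, hsign⟩ :=
    hP N W K p κ 𝔭 𝔭bar hS ι hf hN' hHg hcop hp hsurj hι γ hγF.out h𝔭ns γ𝔭 hγ𝔭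
  obtain ⟨z, B, hB, hbase, _hzF, hT, hdict⟩ := hsign 1
  refine ⟨ΩK, Ωp, L, hΩ, hBDP, z, B, hT, hB, hbase, fun s hs hodd ⟨S, ψ, I, φ, hG, hφ, hper⟩ ↦ ?_⟩
  -- the vertex `∏ s` is definite at torsion level `1`
  have hm : (∏ q ∈ s, q) ∈ CastellaHsuKunduLeeLiu2025.defProducts N K (fun ℓ ↦ W.frobeniusTrace ℓ) p 1 :=
    SignedBaseChangeAcDivAdmdefBipartiteNVLevelOne.prod_mem_defProducts_one hs hodd
  -- the dictionary's Jacquet–Langlands vector `φ_g` and multiplicity one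
  obtain ⟨φg, hφg0, hφg, hiff⟩ := hdict (∏ q ∈ s, q) hm S
  have hφ0 : φ ≠ 0 := by
    rintro rfl
    exact hper (by rw [SignedBaseChangeAcDivOfStubsAdmdefV14.weight_mul_zero]; exact SignedBaseChangeAcDivOfStubsAdmdefV13.toricPeriod_zero S.O ψ I)
  obtain ⟨c, hc⟩ := hM N W K p hN hp hgood hsurj hK hHeeg hram (∏ q ∈ s, q) hm S φg φ hφg hφ hφg0
  -- `φ = c • φ_g`, so `P(φ) = c • P(φ_g) ≠ 0` forces `P(φ_g) ≠ 0`
  have hPg : Brandt.toricPeriod S.O ψ I (fun i ↦ (Brandt.weight S.O i : ZMod p) * φg i) ≠ 0 := by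
    intro h0
    apply hper
    rw [hc, SignedBaseChangeAcDivOfStubsAdmdefV14.weight_mul_smul, SignedBaseChangeAcDivOfStubsAdmdefV13.toricPeriod_smul, h0, smul_zero]
  exact (hiff ψ I hG).mpr hPg

/-- **The crux BY NAME from the four v15 stub texts** (cite stub ×16 · S1∣ · (Anch±) signed [weighted] · γ′): (a2) from Prop. 2.5; on cell β the v4
texts C⁺⁺_{β′}/C⁺⁺_{β″} by §Glue from the BRIDGE (`bridge_text_of_facts`, conjuncts (15)–(16)) and the weighted [NV″]
(`…OfStubsAdmdefV14.definiteToricNVWeighted_of_texts`, conjuncts (12)–(13) + (Anch±)); then the v4 census verbatim.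
[cite: CastellaEtAl2025, Thm. 7.5 and §7.4 (arXiv:2308.10474v2 pp. 31–33)] [cite: WZhang2014, Thm. 9.1 (proof)] -/
theorem anticyclotomicEisensteinDivisibility_of_admdefStubsV15
    (hF : (Literature.NumberTheory.EllipticCurves.YanZhu2026.thm42_XGr₂_isTorsion_charIdeal_le_greenbergAnyRoot ∧
      Literature.NumberTheory.EllipticCurves.YanZhu2026.thm47_ord_localised_iff_greenbergAnyRoot_localised_guarded ∧
      Literature.NumberTheory.EllipticCurves.YanZhu2026.thm33_exists_isHidaRankinLFunction) ∧
    (∀ (W : WeierstrassCurve ℚ) [W.IsGloballyMinimal] (K : Type) [Field K] [NumberField K] (p : ℕ) [Fact p.Prime]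
      (κ : Literature.NumberTheory.EllipticCurves.ZpExtension K p) (𝔭 𝔭' : IsDedekindDomain.HeightOneSpectrum (NumberField.RingOfIntegers K)),
      Literature.NumberTheory.EllipticCurves.AcSigned.longoVigni2019_thm14_signedSelmerDual_rank_one W K p κ 𝔭 𝔭') ∧
    (∀ (N : ℕ) [NeZero N] (W : WeierstrassCurve ℚ) [W.IsGloballyMinimal] (K : Type) [Field K] [NumberField K] (p : ℕ) [Fact p.Prime]
      (κ : Literature.NumberTheory.EllipticCurves.ZpExtension K p) (𝔭 𝔭' : IsDedekindDomain.HeightOneSpectrum (NumberField.RingOfIntegers K)),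
      Literature.NumberTheory.EllipticCurves.AcSigned.castellaWan2024_proofThm68_transferInputs N W K p κ 𝔭 𝔭') ∧
    Literature.NumberTheory.EllipticCurves.BertoliniLongoVenerucci2026.thmA_castellaWan_thm68_exists_isCWBDPLFunction_charIdeal_map_le_rat ∧
    Literature.NumberTheory.IwasawaTheory.Greenberg2016.prop411_selmer_isAlmostDivisible ∧
    Literature.NumberTheory.EllipticCurves.BurungaleCastellaSkinner2025.proofProp422_span_minus_eq_span_bdp_goodReduction ∧
    Literature.NumberTheory.EllipticCurves.BurungaleCastellaSkinner2025.prop422_exists_isBDPLFunction_mu_eq_zero ∧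
    Literature.NumberTheory.EllipticCurves.CastellaHsuKunduLeeLiu2025.thm71_cor72_exists_isCWBDPLFunction_charIdeal_map_le_rat ∧
    (∀ (N : ℕ) [NeZero N] (W : WeierstrassCurve ℚ) [W.IsGloballyMinimal] (K : Type) [Field K] [NumberField K] (p : ℕ) [Fact p.Prime]
      (κ : Literature.NumberTheory.EllipticCurves.ZpExtension K p) (𝔭 𝔭' : IsDedekindDomain.HeightOneSpectrum (NumberField.RingOfIntegers K)),
      Literature.NumberTheory.EllipticCurves.AcSigned.castellaWan2024_lemma67_finrank_torsionCharIdeal N W K p κ 𝔭 𝔭') ∧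
    (∀ (N : ℕ) [NeZero N] (W : WeierstrassCurve ℚ) [W.IsGloballyMinimal] (K : Type) [Field K] [NumberField K] (p : ℕ) [Fact p.Prime]
      (κ : Literature.NumberTheory.EllipticCurves.ZpExtension K p) (𝔭 𝔭' : IsDedekindDomain.HeightOneSpectrum (NumberField.RingOfIntegers K)),
      Literature.NumberTheory.EllipticCurves.AcSigned.castellaWan2024_proofThm68_selmerRel_le_selmerSgn N W K p κ 𝔭 𝔭') ∧
    (∀ (N : ℕ) [NeZero N] (W : WeierstrassCurve ℚ) [W.IsGloballyMinimal] (K : Type) [Field K] [NumberField K] (p : ℕ) [Fact p.Prime]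
      (κ : Literature.NumberTheory.EllipticCurves.ZpExtension K p) (𝔭 𝔭' : IsDedekindDomain.HeightOneSpectrum (NumberField.RingOfIntegers K)),
      Literature.NumberTheory.EllipticCurves.CastellaHsuKunduLeeLiu2025.thm75_howard_rank_one_sq_le_and_le_of_hasUnitLambda N W K p κ 𝔭 𝔭') ∧
    (∀ (K : Type) [Field K] [NumberField K], WeierstrassCurve.exists_casselsTate_pairing (K := K)) ∧
    Literature.NumberTheory.EllipticCurves.dokchitser_selmerCorank_baseChange_mod_two_eq ∧
    Literature.NumberTheory.EllipticCurves.CastellaHsuKunduLeeLiu2025.prop25_XAc_isTorsion ∧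
    Literature.NumberTheory.EllipticCurves.DefiniteMultiplicityOne.kimOta2023_thm55_brandtEigenvector_modP_unique ∧
    Literature.NumberTheory.EllipticCurves.CastellaHsuKunduLeeLiu2025.thm74_eq72_exists_signedSystem_transferClass_dictionary)
    (hDvd : SignedTwoVariableInputs → Literature.NumberTheory.EllipticCurves.ModularForms.nonempty_modularParametrizationData → ∀ (W : WeierstrassCurve ℚ) [W.IsElliptic] [W.IsGloballyMinimal] (p : ℕ) [Fact p.Prime], 5 ≤ p → W.HasGoodReductionAtPrime p → W.frobeniusTrace p = 0 → Literature.NumberTheory.EllipticCurves.Rank1Residual.Surj W p → ∀ (K : Type) [Field K] [NumberField K] (ι : PadicAlgCl p ≃+* ℂ) (v vbar : IsDedekindDomain.HeightOneSpectrum (NumberField.RingOfIntegers K)) (κ₁ κ₂ : Literature.NumberTheory.EllipticCurves.ZpExtension K p) (γ₁ γ₂ : Field.absoluteGaloisGroup K) [Fact (Literature.NumberTheory.EllipticCurves.ZpExtension.IsTopGeneratorPair κ₁ κ₂ γ₁ γ₂)] [NeZero (NumberField.discr K).natAbs] (N : ℕ) [NeZero N] (f : CuspForm (CongruenceSubgroup.Gamma0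 N) 2), Literature.NumberTheory.EllipticCurves.ModularForms.IsNewformOf W f → (N : ℤ) = W.conductorNorm ℤ → Literature.NumberTheory.EllipticCurves.IsImaginaryQuadratic K → ((Ideal.span {(p : ℤ)}).primesOver (NumberField.RingOfIntegers K)).ncard = 2 → ((p : ℕ) : NumberField.RingOfIntegers K) ∈ v.asIdeal → ((p : ℕ) : NumberField.RingOfIntegers K) ∈ vbar.asIdeal → vbar ≠ v → (∀ (w : NumberField.InfinitePlace K) (k : NumberField.RingOfIntegers K), k ∈ v.asIdeal ↔ ‖ι.symm (w.embedding (k : K))‖ < 1) → IsCoprime (N : ℤ) (NumberField.discr K) → (∀ ℓ : ℕ, ℓ.Prime → ℓ ∣ N → ((Ideal.span {(ℓ : ℤ)}).primesOver (NumberField.RingOfIntegers K)).ncard = 2) → Odd (NumberField.discr K) → NumberField.discr K ≠ -3 → κ₁.IsCyclotomic → κ₂.IsAnticyclotomic → p ∣ NumberField.classNumber K → (haveI : Fact (κ₂.IsTopGenerator γ₂) := ⟨Literature.NumberTheory.EllipticCurves.YanZhu2026.isTopGenerator_of_pair (κ₁ := κ₁) (γ₁ := γ₁)⟩; Module.IsTorsion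 (Literature.NumberTheory.EllipticCurves.IwasawaAlgebra p) (Literature.NumberTheory.EllipticCurves.Castella2018.AcSelmer.XAc (W.baseChange K) p κ₂ vbar ∅ γ₂)) → ∀ (ΩK : ℂ) (Ωp' : (Literature.NumberTheory.EllipticCurves.unrIntegers p)ˣ) (L : Literature.NumberTheory.EllipticCurves.UnrSeries p), ΩK ≠ 0 → Literature.NumberTheory.EllipticCurves.IsBDPLFunction ι v κ₂ γ₂ f ΩK ((Ωp' : Literature.NumberTheory.EllipticCurves.unrIntegers p) : PadicComplex p) L → ∀ J : ℤ_[p] →+* PadicComplexInt p, (∀ x : ℤ_[p], ((J x : PadicComplexInt p) : PadicComplex p) = ((x : ℚ_[p]) : PadicComplex p)) → ∀ (J₀ : Literature.NumberTheory.EllipticCurves.unrIntegers p →+* PadicComplexInt p), (∀ x : Literature.NumberTheory.EllipticCurves.unrIntegers p, ((J₀ x : PadicComplexInt p) : PadicComplex p) = (x : PadicComplex p)) → ∃ k : ℕ, ∀ y ∈ (haveI : Fact (κ₂.IsTopGenerator γ₂) := ⟨Literature.NumberTheory.EllipticCurves.YanZhu2026.isTopGenerator_of_pair (κ₁ := κ₁)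 (γ₁ := γ₁)⟩; Literature.NumberTheory.EllipticCurves.Castella2018.AcSelmer.XAc.charIdeal (W.baseChange K) p κ₂ vbar ∅ γ₂).map (PowerSeries.map J), PowerSeries.C (((p : ℕ) : PadicComplexInt p) ^ k) * y ∈ Ideal.span {PowerSeries.map J₀ L})
    (hAnch :
    ∀ {p : ℕ} [Fact p.Prime] (W : WeierstrassCurve ℚ) [W.IsElliptic] [W.IsGloballyMinimal]
      (K : Type) [Field K] [NumberField K] {N : ℕ} [NeZero N] {f : CuspForm (CongruenceSubgroup.Gamma0 N) 2}
      (_ : IsNewformOf W f),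
      (N : ℤ) = W.conductorNorm ℤ → 5 ≤ p → W.HasGoodReductionAtPrime p → W.frobeniusTrace p = 0 →
      Surj W p →
      IsImaginaryQuadratic K → ((Ideal.span {(p : ℤ)}).primesOver (𝓞 K)).ncard = 2 →
      (∀ ℓ : ℕ, ℓ.Prime → ℓ ∣ N → ((Ideal.span {(ℓ : ℤ)}).primesOver (𝓞 K)).ncard = 2) →
      IsCoprime (N : ℤ) (NumberField.discr K) → ¬ p ∣ NumberField.classNumber K →
      ¬ Squarefree N →
      (∀ q : ℕ, q.Prime → q ∣ N →
        ∃ v : HeightOneSpectrum (𝓞 ℚ), ((q : ℕ) : 𝓞 ℚ) ∈ v.asIdeal ∧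
          ∃ 𝔓 ∈ v.primesAbove, ∃ σ ∈ 𝔓.inertia (absoluteGaloisGroup ℚ),
            ∃ P : W.geomTorsion (p : ℤ), σ • P ≠ P) →
      ∀ (c : K ≃ₐ[ℚ] K), c ≠ 1 → ∀ [Module (ZMod p) (AdditiveKoly.Vp W K p)],
        ∀ n : Finset (AdditiveKoly.AdmQ W K p), Odd n.card →
          (∀ s : Bool, ∃ q ∈ n, ∀ v : HeightOneSpectrum (𝓞 K), ((q : ℕ) : 𝓞 K) ∈ v.asIdeal → ∀ z : AdditiveKoly.Vp W K p,
            (W.baseChange K).torsionLocMap (v.adicCompletion K) ((p ^ 1 : ℕ) : ℤ) (conjAct W c ((p ^ 1 : ℕ) : ℤ) z) =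
              AdditiveKoly.sgnP s • (W.baseChange K).torsionLocMap (v.adicCompletion K) ((p ^ 1 : ℕ) : ℤ) z) →
          (∀ μ : Bool, AdditiveKoly.SelQP W K p c n μ = ⊥) →
          ∃ (S : Brandt.XiSetup N (∏ q ∈ n.image Subtype.val, q)) (ψ : K →ₐ[ℚ] S.D) (I : Submodule ℤ S.D)
            (φ : Brandt.ClassSet S.O → ZMod p),
            Brandt.IsGrossPoint S.O ψ I ∧
            (letI : Fintype (Brandt.ClassSet S.O) := Fintype.ofFinite _
             φ ∈ Brandt.eigenSpace (ZMod p) (N * ∏ q ∈ n.image Subtype.val, q) (Brandt.matrix S.O) (fun ℓ ↦ W.frobeniusTrace ℓ)) ∧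
            Brandt.toricPeriod S.O ψ I (fun i ↦ (Brandt.weight S.O i : ZMod p) * φ i) ≠ 0)
    (hU : SignedTwoVariableInputs → Literature.NumberTheory.EllipticCurves.ModularForms.nonempty_modularParametrizationData → ∀ (W : WeierstrassCurve ℚ) [W.IsElliptic] [W.IsGloballyMinimal] (p : ℕ) [Fact p.Prime], 5 ≤ p → W.HasGoodReductionAtPrime p → W.frobeniusTrace p = 0 → Literature.NumberTheory.EllipticCurves.Rank1Residual.Surj W p → ∀ (K : Type) [Field K] [NumberField K] (ι : PadicAlgCl p ≃+* ℂ) (v vbar : IsDedekindDomain.HeightOneSpectrum (NumberField.RingOfIntegers K)) (κ₁ κ₂ : Literature.NumberTheory.EllipticCurves.ZpExtension K p) (γ₁ γ₂ : Field.absoluteGaloisGroup K) [Fact (Literature.NumberTheory.EllipticCurves.ZpExtension.IsTopGeneratorPair κ₁ κ₂ γ₁ γ₂)] [NeZero (NumberField.discr K).natAbs] (N : ℕ) [NeZero N] (f : CuspForm (CongruenceSubgroup.Gamma0 N) 2), Literature.NumberTheory.EllipticCurves.ModularForms.IsNewformOf W f → (N : ℤ) = W.conductorNorm ℤ → Literature.NumberTheory.EllipticCurves.IsImaginaryQuadratic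 K → ¬ p ∣ NumberField.classNumber K → ¬ (∀ q : ℕ, q.Prime → q ∣ N → ∃ v' : IsDedekindDomain.HeightOneSpectrum (NumberField.RingOfIntegers ℚ), ((q : ℕ) : NumberField.RingOfIntegers ℚ) ∈ v'.asIdeal ∧ ∃ 𝔓 ∈ v'.primesAbove, ∃ σ ∈ 𝔓.inertia (Field.absoluteGaloisGroup ℚ), ∃ P : W.geomTorsion (p : ℤ), σ • P ≠ P) → ¬ (∀ ℓ : ℕ, ℓ.Prime → ℓ ∣ N → ℓ ^ 2 ∣ N) → ((Ideal.span {(p : ℤ)}).primesOver (NumberField.RingOfIntegers K)).ncard = 2 → ((p : ℕ) : NumberField.RingOfIntegers K) ∈ v.asIdeal → ((p : ℕ) : NumberField.RingOfIntegers K) ∈ vbar.asIdeal → vbar ≠ v → (∀ (w : NumberField.InfinitePlace K) (k : NumberField.RingOfIntegers K), k ∈ v.asIdeal ↔ ‖ι.symm (w.embedding (k : K))‖ < 1) → IsCoprime (N : ℤ) (NumberField.discr K) → (∀ ℓ : ℕ, ℓ.Prime → ℓ ∣ N → ((Ideal.span {(ℓ : ℤ)}).primesOver (NumberField.RingOfIntegers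 K)).ncard = 2) → Odd (NumberField.discr K) → NumberField.discr K ≠ -3 → κ₁.IsCyclotomic → κ₂.IsAnticyclotomic → (haveI : Fact (κ₂.IsTopGenerator γ₂) := ⟨Literature.NumberTheory.EllipticCurves.YanZhu2026.isTopGenerator_of_pair (κ₁ := κ₁) (γ₁ := γ₁)⟩; Module.IsTorsion (Literature.NumberTheory.EllipticCurves.IwasawaAlgebra p) (Literature.NumberTheory.EllipticCurves.Castella2018.AcSelmer.XAc (W.baseChange K) p κ₂ vbar ∅ γ₂)) → ∀ (ΩK : ℂ) (Ωp' : (Literature.NumberTheory.EllipticCurves.unrIntegers p)ˣ) (L : Literature.NumberTheory.EllipticCurves.UnrSeries p), ΩK ≠ 0 → Literature.NumberTheory.EllipticCurves.IsBDPLFunction ι v κ₂ γ₂ f ΩK ((Ωp' : Literature.NumberTheory.EllipticCurves.unrIntegers p) : PadicComplex p) L → ∀ J : ℤ_[p] →+* PadicComplexInt p, (∀ x : ℤ_[p], ((J x : PadicComplexInt p) : PadicComplex p) = ((x : ℚ_[p]) : PadicComplex p)) → ∀ (J₀ : Literature.NumberTheory.EllipticCurves.unrIntegers p →+* PadicComplexInt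 p), (∀ x : Literature.NumberTheory.EllipticCurves.unrIntegers p, ((J₀ x : PadicComplexInt p) : PadicComplex p) = (x : PadicComplex p)) → ∃ k : ℕ, ∀ y ∈ (haveI : Fact (κ₂.IsTopGenerator γ₂) := ⟨Literature.NumberTheory.EllipticCurves.YanZhu2026.isTopGenerator_of_pair (κ₁ := κ₁) (γ₁ := γ₁)⟩; Literature.NumberTheory.EllipticCurves.Castella2018.AcSelmer.XAc.charIdeal (W.baseChange K) p κ₂ vbar ∅ γ₂).map (PowerSeries.map J), PowerSeries.C (((p : ℕ) : PadicComplexInt p) ^ k) * y ∈ Ideal.span {PowerSeries.map J₀ L}) :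
    Summit.BirchSwinnertonDyer.BirchSwinnertonDyer.Theses.SignedBaseChange.AnticyclotomicEisensteinDivisibility := by
  obtain ⟨hYZ, hLV, hTI, hBLV, hGr, hBCS1, hBCS2, hCH71, hCW67, hCWrel, hCH75, hCT, hDD, hP25, hM1, hP01⟩ := hF
  have hBr := @bridge_text_of_facts hP01 hM1
  have hNV := @SignedBaseChangeAcDivOfStubsAdmdefV14.definiteToricNVWeighted_of_texts hCT hDD hAnch
  refine SignedBaseChangeAcDivOfStubsAdmdefV4.anticyclotomicEisensteinDivisibility_of_admdefStubsV4 ⟨hYZ, hLV, hTI, hBLV, hGr, hBCS1, hBCS2, hCH71⟩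
    (SignedBaseChangeAcDivAdmdefXAcTorsionOfProp25.xAcTorsionSS_classDvd_of_prop25 hP25) hDvd ?_ ?_ hU
  · intro p _ ι W _ _ K _ _ 𝔭 𝔭bar κ γ hγF N _ f hf hN hp hgood hap hsurj hK hsplit h𝔭 hι h𝔭bar hne hHeeg hcop hh hnsq _h2m hram hac
    refine SignedBaseChangeAcDivAdmdefBipartiteNVGlue.exists_isCWBDPLFunction_charIdeal_map_le_of_bipartiteNV hLV hCW67 hCWrel
      hCH75 ι W K 𝔭 𝔭bar κ γ hf hN hp hgood hap hsurj hK h𝔭 hι h𝔭bar hne hHeeg hcop hh hac ?_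
    intro h𝔭ns γ𝔭 hγ𝔭
    obtain ⟨ΩK, Ωp, L, hΩ, hBDP, z, B, hTz, hB, hbase, hbridge⟩ :=
      hBr ι W K 𝔭 𝔭bar κ γ hf hN hp hgood hap hsurj hK hsplit h𝔭 hι h𝔭bar hne hHeeg hcop hh hnsq hram hac h𝔭ns γ𝔭 hγ𝔭
    obtain ⟨s, hs, hodd, S, ψ, I, φ, hG, hφ, hper⟩ :=
      hNV W K hf hN hp hgood hap hsurj hK hsplit hHeeg hcop hh hnsq hram
    exact ⟨ΩK, Ωp, L, hΩ, hBDP, z, B, hTz, hB, hbase,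
      ⟨1, one_pos, ∏ q ∈ s, q, SignedBaseChangeAcDivAdmdefBipartiteNVLevelOne.prod_mem_defProducts_one hs hodd,
        hbridge s hs hodd ⟨S, ψ, I, φ, hG, hφ, hper⟩⟩⟩
  · intro p _ ι W _ _ K _ _ 𝔭 𝔭bar κ γ hγF N _ f hf hN hp hgood hap hsurj hK hsplit h𝔭 hι h𝔭bar hne hHeeg hcop hh hnsq _h2m hram hac
    refine SignedBaseChangeAcDivAdmdefBipartiteNVGlue.exists_isCWBDPLFunction_charIdeal_map_le_of_bipartiteNV hLV hCW67 hCWrel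
      hCH75 ι W K 𝔭 𝔭bar κ γ hf hN hp hgood hap hsurj hK h𝔭 hι h𝔭bar hne hHeeg hcop hh hac ?_
    intro h𝔭ns γ𝔭 hγ𝔭
    obtain ⟨ΩK, Ωp, L, hΩ, hBDP, z, B, hTz, hB, hbase, hbridge⟩ :=
      hBr ι W K 𝔭 𝔭bar κ γ hf hN hp hgood hap hsurj hK hsplit h𝔭 hι h𝔭bar hne hHeeg hcop hh hnsq hram hac h𝔭ns γ𝔭 hγ𝔭
    obtain ⟨s, hs, hodd, S, ψ, I, φ, hG, hφ, hper⟩ :=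
      hNV W K hf hN hp hgood hap hsurj hK hsplit hHeeg hcop hh hnsq hram
    exact ⟨ΩK, Ωp, L, hΩ, hBDP, z, B, hTz, hB, hbase,
      ⟨1, one_pos, ∏ q ∈ s, q, SignedBaseChangeAcDivAdmdefBipartiteNVLevelOne.prod_mem_defProducts_one hs hodd,
        hbridge s hs hodd ⟨S, ψ, I, φ, hG, hφ, hper⟩⟩⟩

/-- **The same WITHOUT the BLV∘CW conjunct (4)** (road `…_of_noBLV`: the term does not use `hF`'s conjunct (4)). [cite: WZhang2014, Thm. 9.1 (proof)]
[cite: CastellaEtAl2025, Thm. 7.5 and §7.4 (arXiv:2308.10474v2 pp. 31–33)] -/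
theorem anticyclotomicEisensteinDivisibility_of_admdefStubsV15_noBLV
    (hF : (Literature.NumberTheory.EllipticCurves.YanZhu2026.thm42_XGr₂_isTorsion_charIdeal_le_greenbergAnyRoot ∧
      Literature.NumberTheory.EllipticCurves.YanZhu2026.thm47_ord_localised_iff_greenbergAnyRoot_localised_guarded ∧
      Literature.NumberTheory.EllipticCurves.YanZhu2026.thm33_exists_isHidaRankinLFunction) ∧
    (∀ (W : WeierstrassCurve ℚ) [W.IsGloballyMinimal] (K : Type) [Field K] [NumberField K] (p : ℕ) [Fact p.Prime]
      (κ : Literature.NumberTheory.EllipticCurves.ZpExtension K p) (𝔭 𝔭' : IsDedekindDomain.HeightOneSpectrum (NumberField.RingOfIntegers K)),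
      Literature.NumberTheory.EllipticCurves.AcSigned.longoVigni2019_thm14_signedSelmerDual_rank_one W K p κ 𝔭 𝔭') ∧
    (∀ (N : ℕ) [NeZero N] (W : WeierstrassCurve ℚ) [W.IsGloballyMinimal] (K : Type) [Field K] [NumberField K] (p : ℕ) [Fact p.Prime]
      (κ : Literature.NumberTheory.EllipticCurves.ZpExtension K p) (𝔭 𝔭' : IsDedekindDomain.HeightOneSpectrum (NumberField.RingOfIntegers K)),
      Literature.NumberTheory.EllipticCurves.AcSigned.castellaWan2024_proofThm68_transferInputs N W K p κ 𝔭 𝔭') ∧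
    Literature.NumberTheory.EllipticCurves.BertoliniLongoVenerucci2026.thmA_castellaWan_thm68_exists_isCWBDPLFunction_charIdeal_map_le_rat ∧
    Literature.NumberTheory.IwasawaTheory.Greenberg2016.prop411_selmer_isAlmostDivisible ∧
    Literature.NumberTheory.EllipticCurves.BurungaleCastellaSkinner2025.proofProp422_span_minus_eq_span_bdp_goodReduction ∧
    Literature.NumberTheory.EllipticCurves.BurungaleCastellaSkinner2025.prop422_exists_isBDPLFunction_mu_eq_zero ∧
    Literature.NumberTheory.EllipticCurves.CastellaHsuKunduLeeLiu2025.thm71_cor72_exists_isCWBDPLFunction_charIdeal_map_le_rat ∧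
    (∀ (N : ℕ) [NeZero N] (W : WeierstrassCurve ℚ) [W.IsGloballyMinimal] (K : Type) [Field K] [NumberField K] (p : ℕ) [Fact p.Prime]
      (κ : Literature.NumberTheory.EllipticCurves.ZpExtension K p) (𝔭 𝔭' : IsDedekindDomain.HeightOneSpectrum (NumberField.RingOfIntegers K)),
      Literature.NumberTheory.EllipticCurves.AcSigned.castellaWan2024_lemma67_finrank_torsionCharIdeal N W K p κ 𝔭 𝔭') ∧
    (∀ (N : ℕ) [NeZero N] (W : WeierstrassCurve ℚ) [W.IsGloballyMinimal] (K : Type) [Field K] [NumberField K] (p : ℕ) [Fact p.Prime]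
      (κ : Literature.NumberTheory.EllipticCurves.ZpExtension K p) (𝔭 𝔭' : IsDedekindDomain.HeightOneSpectrum (NumberField.RingOfIntegers K)),
      Literature.NumberTheory.EllipticCurves.AcSigned.castellaWan2024_proofThm68_selmerRel_le_selmerSgn N W K p κ 𝔭 𝔭') ∧
    (∀ (N : ℕ) [NeZero N] (W : WeierstrassCurve ℚ) [W.IsGloballyMinimal] (K : Type) [Field K] [NumberField K] (p : ℕ) [Fact p.Prime]
      (κ : Literature.NumberTheory.EllipticCurves.ZpExtension K p) (𝔭 𝔭' : IsDedekindDomain.HeightOneSpectrum (NumberField.RingOfIntegers K)),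
      Literature.NumberTheory.EllipticCurves.CastellaHsuKunduLeeLiu2025.thm75_howard_rank_one_sq_le_and_le_of_hasUnitLambda N W K p κ 𝔭 𝔭') ∧
    (∀ (K : Type) [Field K] [NumberField K], WeierstrassCurve.exists_casselsTate_pairing (K := K)) ∧
    Literature.NumberTheory.EllipticCurves.dokchitser_selmerCorank_baseChange_mod_two_eq ∧
    Literature.NumberTheory.EllipticCurves.CastellaHsuKunduLeeLiu2025.prop25_XAc_isTorsion ∧
    Literature.NumberTheory.EllipticCurves.DefiniteMultiplicityOne.kimOta2023_thm55_brandtEigenvector_modP_unique ∧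
    Literature.NumberTheory.EllipticCurves.CastellaHsuKunduLeeLiu2025.thm74_eq72_exists_signedSystem_transferClass_dictionary)
    (hDvd : SignedTwoVariableInputs → Literature.NumberTheory.EllipticCurves.ModularForms.nonempty_modularParametrizationData → ∀ (W : WeierstrassCurve ℚ) [W.IsElliptic] [W.IsGloballyMinimal] (p : ℕ) [Fact p.Prime], 5 ≤ p → W.HasGoodReductionAtPrime p → W.frobeniusTrace p = 0 → Literature.NumberTheory.EllipticCurves.Rank1Residual.Surj W p → ∀ (K : Type) [Field K] [NumberField K] (ι : PadicAlgCl p ≃+* ℂ) (v vbar : IsDedekindDomain.HeightOneSpectrum (NumberField.RingOfIntegers K)) (κ₁ κ₂ : Literature.NumberTheory.EllipticCurves.ZpExtension K p) (γ₁ γ₂ : Field.absoluteGaloisGroup K) [Fact (Literature.NumberTheory.EllipticCurves.ZpExtension.IsTopGeneratorPair κ₁ κ₂ γ₁ γ₂)] [NeZero (NumberField.discr K).natAbs] (N : ℕ) [NeZero N] (f : CuspForm (CongruenceSubgroup.Gamma0 N) 2), Literature.NumberTheory.EllipticCurves.ModularForms.IsNewformOf W f → (N : ℤ) = W.conductorNorm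 ℤ → Literature.NumberTheory.EllipticCurves.IsImaginaryQuadratic K → ((Ideal.span {(p : ℤ)}).primesOver (NumberField.RingOfIntegers K)).ncard = 2 → ((p : ℕ) : NumberField.RingOfIntegers K) ∈ v.asIdeal → ((p : ℕ) : NumberField.RingOfIntegers K) ∈ vbar.asIdeal → vbar ≠ v → (∀ (w : NumberField.InfinitePlace K) (k : NumberField.RingOfIntegers K), k ∈ v.asIdeal ↔ ‖ι.symm (w.embedding (k : K))‖ < 1) → IsCoprime (N : ℤ) (NumberField.discr K) → (∀ ℓ : ℕ, ℓ.Prime → ℓ ∣ N → ((Ideal.span {(ℓ : ℤ)}).primesOver (NumberField.RingOfIntegers K)).ncard = 2) → Odd (NumberField.discr K) → NumberField.discr K ≠ -3 → κ₁.IsCyclotomic → κ₂.IsAnticyclotomic → p ∣ NumberField.classNumber K → (haveI : Fact (κ₂.IsTopGenerator γ₂) := ⟨Literature.NumberTheory.EllipticCurves.YanZhu2026.isTopGenerator_of_pair (κ₁ := κ₁) (γ₁ := γ₁)⟩; Module.IsTorsion (Literature.NumberTheory.EllipticCurves.IwasawaAlgebra p) (Literature.NumberTheory.EllipticCurves.Castella2018.AcSelmer.XAc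 (W.baseChange K) p κ₂ vbar ∅ γ₂)) → ∀ (ΩK : ℂ) (Ωp' : (Literature.NumberTheory.EllipticCurves.unrIntegers p)ˣ) (L : Literature.NumberTheory.EllipticCurves.UnrSeries p), ΩK ≠ 0 → Literature.NumberTheory.EllipticCurves.IsBDPLFunction ι v κ₂ γ₂ f ΩK ((Ωp' : Literature.NumberTheory.EllipticCurves.unrIntegers p) : PadicComplex p) L → ∀ J : ℤ_[p] →+* PadicComplexInt p, (∀ x : ℤ_[p], ((J x : PadicComplexInt p) : PadicComplex p) = ((x : ℚ_[p]) : PadicComplex p)) → ∀ (J₀ : Literature.NumberTheory.EllipticCurves.unrIntegers p →+* PadicComplexInt p), (∀ x : Literature.NumberTheory.EllipticCurves.unrIntegers p, ((J₀ x : PadicComplexInt p) : PadicComplex p) = (x : PadicComplex p)) → ∃ k : ℕ, ∀ y ∈ (haveI : Fact (κ₂.IsTopGenerator γ₂) := ⟨Literature.NumberTheory.EllipticCurves.YanZhu2026.isTopGenerator_of_pair (κ₁ := κ₁) (γ₁ := γ₁)⟩; Literature.NumberTheory.EllipticCurves.Castella2018.AcSelmer.XAc.charIdeal (W.baseChange K)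 p κ₂ vbar ∅ γ₂).map (PowerSeries.map J), PowerSeries.C (((p : ℕ) : PadicComplexInt p) ^ k) * y ∈ Ideal.span {PowerSeries.map J₀ L})
    (hAnch :
    ∀ {p : ℕ} [Fact p.Prime] (W : WeierstrassCurve ℚ) [W.IsElliptic] [W.IsGloballyMinimal]
      (K : Type) [Field K] [NumberField K] {N : ℕ} [NeZero N] {f : CuspForm (CongruenceSubgroup.Gamma0 N) 2}
      (_ : IsNewformOf W f),
      (N : ℤ) = W.conductorNorm ℤ → 5 ≤ p → W.HasGoodReductionAtPrime p → W.frobeniusTrace p = 0 →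
      Surj W p →
      IsImaginaryQuadratic K → ((Ideal.span {(p : ℤ)}).primesOver (𝓞 K)).ncard = 2 →
      (∀ ℓ : ℕ, ℓ.Prime → ℓ ∣ N → ((Ideal.span {(ℓ : ℤ)}).primesOver (𝓞 K)).ncard = 2) →
      IsCoprime (N : ℤ) (NumberField.discr K) → ¬ p ∣ NumberField.classNumber K →
      ¬ Squarefree N →
      (∀ q : ℕ, q.Prime → q ∣ N →
        ∃ v : HeightOneSpectrum (𝓞 ℚ), ((q : ℕ) : 𝓞 ℚ) ∈ v.asIdeal ∧
          ∃ 𝔓 ∈ v.primesAbove, ∃ σ ∈ 𝔓.inertia (absoluteGaloisGroup ℚ),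
            ∃ P : W.geomTorsion (p : ℤ), σ • P ≠ P) →
      ∀ (c : K ≃ₐ[ℚ] K), c ≠ 1 → ∀ [Module (ZMod p) (AdditiveKoly.Vp W K p)],
        ∀ n : Finset (AdditiveKoly.AdmQ W K p), Odd n.card →
          (∀ s : Bool, ∃ q ∈ n, ∀ v : HeightOneSpectrum (𝓞 K), ((q : ℕ) : 𝓞 K) ∈ v.asIdeal → ∀ z : AdditiveKoly.Vp W K p,
            (W.baseChange K).torsionLocMap (v.adicCompletion K) ((p ^ 1 : ℕ) : ℤ) (conjAct W c ((p ^ 1 : ℕ) : ℤ) z) =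
              AdditiveKoly.sgnP s • (W.baseChange K).torsionLocMap (v.adicCompletion K) ((p ^ 1 : ℕ) : ℤ) z) →
          (∀ μ : Bool, AdditiveKoly.SelQP W K p c n μ = ⊥) →
          ∃ (S : Brandt.XiSetup N (∏ q ∈ n.image Subtype.val, q)) (ψ : K →ₐ[ℚ] S.D) (I : Submodule ℤ S.D)
            (φ : Brandt.ClassSet S.O → ZMod p),
            Brandt.IsGrossPoint S.O ψ I ∧
            (letI : Fintype (Brandt.ClassSet S.O) := Fintype.ofFinite _
             φ ∈ Brandt.eigenSpace (ZMod p) (N * ∏ q ∈ n.image Subtype.val, q) (Brandt.matrix S.O) (fun ℓ ↦ W.frobeniusTrace ℓ)) ∧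
            Brandt.toricPeriod S.O ψ I (fun i ↦ (Brandt.weight S.O i : ZMod p) * φ i) ≠ 0)
    (hU : SignedTwoVariableInputs → Literature.NumberTheory.EllipticCurves.ModularForms.nonempty_modularParametrizationData → ∀ (W : WeierstrassCurve ℚ) [W.IsElliptic] [W.IsGloballyMinimal] (p : ℕ) [Fact p.Prime], 5 ≤ p → W.HasGoodReductionAtPrime p → W.frobeniusTrace p = 0 → Literature.NumberTheory.EllipticCurves.Rank1Residual.Surj W p → ∀ (K : Type) [Field K] [NumberField K] (ι : PadicAlgCl p ≃+* ℂ) (v vbar : IsDedekindDomain.HeightOneSpectrum (NumberField.RingOfIntegers K)) (κ₁ κ₂ : Literature.NumberTheory.EllipticCurves.ZpExtension K p) (γ₁ γ₂ : Field.absoluteGaloisGroup K) [Fact (Literature.NumberTheory.EllipticCurves.ZpExtension.IsTopGeneratorPair κ₁ κ₂ γ₁ γ₂)] [NeZero (NumberField.discr K).natAbs] (N : ℕ) [NeZero N] (f : CuspForm (CongruenceSubgroup.Gamma0 N) 2), Literature.NumberTheory.EllipticCurves.ModularForms.IsNewformOf W f → (N : ℤ) = W.conductorNorm ℤ → Literature.NumberTheory.EllipticCurves.IsImaginaryQuadratic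 K → ¬ p ∣ NumberField.classNumber K → ¬ (∀ q : ℕ, q.Prime → q ∣ N → ∃ v' : IsDedekindDomain.HeightOneSpectrum (NumberField.RingOfIntegers ℚ), ((q : ℕ) : NumberField.RingOfIntegers ℚ) ∈ v'.asIdeal ∧ ∃ 𝔓 ∈ v'.primesAbove, ∃ σ ∈ 𝔓.inertia (Field.absoluteGaloisGroup ℚ), ∃ P : W.geomTorsion (p : ℤ), σ • P ≠ P) → ¬ (∀ ℓ : ℕ, ℓ.Prime → ℓ ∣ N → ℓ ^ 2 ∣ N) → ((Ideal.span {(p : ℤ)}).primesOver (NumberField.RingOfIntegers K)).ncard = 2 → ((p : ℕ) : NumberField.RingOfIntegers K) ∈ v.asIdeal → ((p : ℕ) : NumberField.RingOfIntegers K) ∈ vbar.asIdeal → vbar ≠ v → (∀ (w : NumberField.InfinitePlace K) (k : NumberField.RingOfIntegers K), k ∈ v.asIdeal ↔ ‖ι.symm (w.embedding (k : K))‖ < 1) → IsCoprime (N : ℤ) (NumberField.discr K) → (∀ ℓ : ℕ, ℓ.Prime → ℓ ∣ N → ((Ideal.span {(ℓ : ℤ)}).primesOver (NumberField.RingOfIntegers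 K)).ncard = 2) → Odd (NumberField.discr K) → NumberField.discr K ≠ -3 → κ₁.IsCyclotomic → κ₂.IsAnticyclotomic → (haveI : Fact (κ₂.IsTopGenerator γ₂) := ⟨Literature.NumberTheory.EllipticCurves.YanZhu2026.isTopGenerator_of_pair (κ₁ := κ₁) (γ₁ := γ₁)⟩; Module.IsTorsion (Literature.NumberTheory.EllipticCurves.IwasawaAlgebra p) (Literature.NumberTheory.EllipticCurves.Castella2018.AcSelmer.XAc (W.baseChange K) p κ₂ vbar ∅ γ₂)) → ∀ (ΩK : ℂ) (Ωp' : (Literature.NumberTheory.EllipticCurves.unrIntegers p)ˣ) (L : Literature.NumberTheory.EllipticCurves.UnrSeries p), ΩK ≠ 0 → Literature.NumberTheory.EllipticCurves.IsBDPLFunction ι v κ₂ γ₂ f ΩK ((Ωp' : Literature.NumberTheory.EllipticCurves.unrIntegers p) : PadicComplex p) L → ∀ J : ℤ_[p] →+* PadicComplexInt p, (∀ x : ℤ_[p], ((J x : PadicComplexInt p) : PadicComplex p) = ((x : ℚ_[p]) : PadicComplex p)) → ∀ (J₀ : Literature.NumberTheory.EllipticCurves.unrIntegers p →+* PadicComplexInt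 p), (∀ x : Literature.NumberTheory.EllipticCurves.unrIntegers p, ((J₀ x : PadicComplexInt p) : PadicComplex p) = (x : PadicComplex p)) → ∃ k : ℕ, ∀ y ∈ (haveI : Fact (κ₂.IsTopGenerator γ₂) := ⟨Literature.NumberTheory.EllipticCurves.YanZhu2026.isTopGenerator_of_pair (κ₁ := κ₁) (γ₁ := γ₁)⟩; Literature.NumberTheory.EllipticCurves.Castella2018.AcSelmer.XAc.charIdeal (W.baseChange K) p κ₂ vbar ∅ γ₂).map (PowerSeries.map J), PowerSeries.C (((p : ℕ) : PadicComplexInt p) ^ k) * y ∈ Ideal.span {PowerSeries.map J₀ L}) :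
    Summit.BirchSwinnertonDyer.BirchSwinnertonDyer.Theses.SignedBaseChange.AnticyclotomicEisensteinDivisibility := by
  obtain ⟨hYZ, hLV, hTI, hBLV, hGr, hBCS1, hBCS2, hCH71, hCW67, hCWrel, hCH75, hCT, hDD, hP25, hM1, hP01⟩ := hF
  have hBr := @bridge_text_of_facts hP01 hM1
  have hNV := @SignedBaseChangeAcDivOfStubsAdmdefV14.definiteToricNVWeighted_of_texts hCT hDD hAnch
  refine SignedBaseChangeAcDivOfStubsAdmdefV4.anticyclotomicEisensteinDivisibility_of_admdefStubsV4_noBLV ⟨hYZ, hLV, hTI, hBLV, hGr, hBCS1, hBCS2, hCH71⟩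
    (SignedBaseChangeAcDivAdmdefXAcTorsionOfProp25.xAcTorsionSS_classDvd_of_prop25 hP25) hDvd ?_ ?_ hU
  · intro p _ ι W _ _ K _ _ 𝔭 𝔭bar κ γ hγF N _ f hf hN hp hgood hap hsurj hK hsplit h𝔭 hι h𝔭bar hne hHeeg hcop hh hnsq _h2m hram hac
    refine SignedBaseChangeAcDivAdmdefBipartiteNVGlue.exists_isCWBDPLFunction_charIdeal_map_le_of_bipartiteNV hLV hCW67 hCWrel
      hCH75 ι W K 𝔭 𝔭bar κ γ hf hN hp hgood hap hsurj hK h𝔭 hι h𝔭bar hne hHeeg hcop hh hac ?_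
    intro h𝔭ns γ𝔭 hγ𝔭
    obtain ⟨ΩK, Ωp, L, hΩ, hBDP, z, B, hTz, hB, hbase, hbridge⟩ :=
      hBr ι W K 𝔭 𝔭bar κ γ hf hN hp hgood hap hsurj hK hsplit h𝔭 hι h𝔭bar hne hHeeg hcop hh hnsq hram hac h𝔭ns γ𝔭 hγ𝔭
    obtain ⟨s, hs, hodd, S, ψ, I, φ, hG, hφ, hper⟩ :=
      hNV W K hf hN hp hgood hap hsurj hK hsplit hHeeg hcop hh hnsq hram
    exact ⟨ΩK, Ωp, L, hΩ, hBDP, z, B, hTz, hB, hbase,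
      ⟨1, one_pos, ∏ q ∈ s, q, SignedBaseChangeAcDivAdmdefBipartiteNVLevelOne.prod_mem_defProducts_one hs hodd,
        hbridge s hs hodd ⟨S, ψ, I, φ, hG, hφ, hper⟩⟩⟩
  · intro p _ ι W _ _ K _ _ 𝔭 𝔭bar κ γ hγF N _ f hf hN hp hgood hap hsurj hK hsplit h𝔭 hι h𝔭bar hne hHeeg hcop hh hnsq _h2m hram hac
    refine SignedBaseChangeAcDivAdmdefBipartiteNVGlue.exists_isCWBDPLFunction_charIdeal_map_le_of_bipartiteNV hLV hCW67 hCWrel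
      hCH75 ι W K 𝔭 𝔭bar κ γ hf hN hp hgood hap hsurj hK h𝔭 hι h𝔭bar hne hHeeg hcop hh hac ?_
    intro h𝔭ns γ𝔭 hγ𝔭
    obtain ⟨ΩK, Ωp, L, hΩ, hBDP, z, B, hTz, hB, hbase, hbridge⟩ :=
      hBr ι W K 𝔭 𝔭bar κ γ hf hN hp hgood hap hsurj hK hsplit h𝔭 hι h𝔭bar hne hHeeg hcop hh hnsq hram hac h𝔭ns γ𝔭 hγ𝔭
    obtain ⟨s, hs, hodd, S, ψ, I, φ, hG, hφ, hper⟩ :=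
      hNV W K hf hN hp hgood hap hsurj hK hsplit hHeeg hcop hh hnsq hram
    exact ⟨ΩK, Ωp, L, hΩ, hBDP, z, B, hTz, hB, hbase,
      ⟨1, one_pos, ∏ q ∈ s, q, SignedBaseChangeAcDivAdmdefBipartiteNVLevelOne.prod_mem_defProducts_one hs hodd,
        hbridge s hs hodd ⟨S, ψ, I, φ, hG, hφ, hper⟩⟩⟩

end Summit.BirchSwinnertonDyer.BirchSwinnertonDyer.Theorems.SignedBaseChangeAcDivOfStubsAdmdefV15

end
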